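import Mathlib

/-!
# STUB-IDEAS k2 (gen 10) — kernel-checked bookkeeping for `stub_heegnerIndexLowerAtTwo`

Route `PrintCf2`, crux `SplitBadTwoLowerHalfOfFacts` (stmt-BirchSwinnertonDyer-27851), stub
`stub_heegnerIndexLowerAtTwo` (`ord₂ #Ш_an(E/K) ≤ ord₂ #Ш(E/K)` on every Heegner frame of the class
`49a1^{(d)}, 49a2^{(d)}`, `d ≢ 1 (mod 4)`, CM by `K₀ = ℚ(√−7)`, `2 = v v̄` split, additive at `2`).

**BSD is NOT proved by anything in this file; the stub is NOT closed.**  Every declaration below is an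
elementary, sorry-free bookkeeping lemma that TYPES one digit of the value-road audit list
(critic's STUB-PLAN v2.7, §4 T3.3′ / §6 R78, R83):

* § A — P-audit-LZZ (ii): the dyadic split stable pair of Liu–Zhang–Zhang (arXiv:1511.08172,
  Lemma 4.6 `(eq:matrix_tame)` + Lemma 4.7, p. 21): `α♮_𝔭 = C_𝔭 · Z₊ Z₋ = C_𝔭 · c₊ c₋ ≠ 0` for every
  ramified `χ̌` of depth `≤ n` (and `Q = (L²/ε) · α♮_𝔭`), with the 2-adic digits `v₂(C_𝔭) = −1`
  (Hensel witness for the unit Satake root of `X² − X + 2`) and `v₂(α♮_𝔭) = 1 − 2 n_v`; YZZ13 normalise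
  `α_v` by the same factor (book p. 13), so this common factor cancels in the LZZ ÷ YZZ quotient.
* § B — R78: the ONE dyadic split toric integral in four printed normalisations
  (LZZ indicator pair / Gross–Prasad translated newform à la File–Martin–Pitale 2017 Prop. 3.1 /
  Hsieh 2014 Lemma 3.4–Prop. 3.5 `♭`-vector), as a digit table at `n_v ∈ {2,3}`.
* § C — P-audit-LZZ (iii): the torus-measure seam for `K₀` (`μ^{LZZ} = ½ · μ^{Tam}` on `T(𝔸)`,
  finite parts agree with YZZ13 §1.6), class-constant and free of the divisor count `V(d)`.
* § D — R83(b): the weight-`k` shadow: factorial parts of the Maass–Shimura/archimedean digit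
  (`(k−1)!·k!`, Hsieh Prop. 3.3 / LZZ Lemma 2.25–2.26) against Katz–de Shalit (`k!·(k−1)!` at the
  in-range infinity types `(k+1,−k)`, `(k,1−k)`) cancel exactly; a hypothetical factorial mismatch
  would leave the residue `k`, of unbounded valuation along `k = 2^N`; and NO `k`-linear 2-adic slope
  can survive 2-adic convergence to a nonzero limit (`no_slope`).

No `instance`, no `notation`, no `axiom`, no `sorry`.
-/

namespace Summit.BirchSwinnertonDyer.BirchSwinnertonDyer.Cruxes.SplitBadTwoLowerHalfOfFacts.HeegnerIndexTwo.K2G10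

/-! ## § A.  P-audit-LZZ (ii): the dyadic split stable pair -/

/-- Hensel witness.  Modulo `64` the Hecke polynomial `X² − X + 2` of the good-at-2 CM partner
(`a₂ = 1`; for `a₂ = −1` replace `X` by `−X`) has exactly the two roots `27` (the 2-adic UNIT root `α`)
and `38` (the root `β = 2/α` of valuation `1`). -/
theorem heckeRoots_mod64 :
    ∀ x : ZMod 64, x ^ 2 - x + 2 = 0 ↔ (x = 27 ∨ x = 38) := by
  decide

/-- The three 2-adic digits entering `L₂(1, π, Ad)⁻¹ = ((4 − α²)/4) · (1/2) · ((4 − β²)/4)` with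
`4 − β² = 4(α² − 1)/α²`:  `4 − α²` is odd, `v₂(α − 1) = 1`, `v₂(α + 1) = 2`
(read off `α ≡ 27 (mod 64)`: `α² ≡ 25`, `α − 1 ≡ 26`, `α + 1 ≡ 28`). -/
theorem adjointDigits_mod64 :
    (27 : ZMod 64) ^ 2 = 25 ∧ ((4 : ZMod 2) - 25 ≠ 0) ∧
      (2 ∣ 26 ∧ ¬ 4 ∣ 26) ∧ (4 ∣ 28 ∧ ¬ 8 ∣ 28) := by
  decide

/-- `v₂ (L₂(1,π,Ad)⁻¹) = (0 − 2) + (−1) + ((2 + 1 + 2) − 2) = 0`, hence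
`v₂(C_𝔭) = v₂ L₂(1,η) + v₂ L₂(1,π,Ad) − v₂ ζ₂(2) = 1 + 0 − 2 = −1`
(`η₂` trivial because `2` splits in `K₀`: `L₂(1,η) = (1 − 2⁻¹)⁻¹ = 2`; `ζ₂(2) = 4/3`). -/
theorem cP_digit :
    ((0 : ℤ) - 2) + (-1) + ((2 + 1 + 2) - 2) = 0 ∧ (1 : ℤ) + 0 - 2 = -1 := by
  norm_num

/-- The rational values themselves: `L₂(1,η) = 2`, `ζ₂(2) = 4/3`. -/
theorem splitEulerValues :
    ((1 : ℚ) - 2⁻¹)⁻¹ = 2 ∧ ((1 : ℚ) - (2 ^ 2 : ℚ)⁻¹)⁻¹ = 4 / 3 := by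
  norm_num

/-- 2-adic digit of the LZZ stable-pair local period `α♮_𝔭 = C_𝔭 · Z₊ · Z₋` at a split dyadic place for a
ramified character of depth `≤ n` (both Kirillov indicators supported on `1 + 2ⁿ ℤ₂`, `vol(ℤ₂ˣ) = 1`,
`Z_± = L(½, Π^± ⊗ χ̌^{±1})⁻¹ · c_±` with the `L`-factor `= 1`):
`v₂(C_𝔭) + v₂(c₊ c₋) + 0 − 2 · v₂(L) = (−1) + (−2(n−1)) + 0 − 0 = 1 − 2n`. -/
def lzzSplitDigit (n : ℕ) : ℤ := -1 + (-2 * ((n : ℤ) - 1)) + 0 - 2 * 0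

theorem lzzSplitDigit_eq (n : ℕ) : lzzSplitDigit n = 1 - 2 * (n : ℤ) := by
  unfold lzzSplitDigit; ring

/-- The two depths that occur on the class (`n_v = 2` for the odd keys, `n_v = 3` for the even keys). -/
theorem lzzSplitDigit_keys : lzzSplitDigit 2 = -3 ∧ lzzSplitDigit 3 = -5 := by
  simp [lzzSplitDigit]

/-- Epsilon-factor digit: for a ramified character `χ̌` of conductor `2ⁿ` with unitary values,
`ε(½, χ̌, ψ) = G(χ̌)/2^{n/2} · (root of unity)` and `v₂ G(χ̌) = n/2` (purity `|G|² = 2ⁿ` read in the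
totally ramified field `ℚ₂(ζ_{2^∞})`), so `v₂ ε(½, ψ, ρ ⊗ χ̌) = 2 · (n/2 − n/2) = 0`. -/
theorem epsilonDigit (n : ℚ) : 2 * (n / 2 - n / 2) = 0 := by ring

/-! ## § B.  R78: one dyadic split toric integral, four printed normalisations -/

/-- File–Martin–Pitale 2017 Prop. 3.1 (any residue characteristic): the zeta integral of the
Gross–Prasad translate `π(diag-unipotent(ϖ^{-c})) W₀` against `μ⁻¹`, `c = c(μ) > 0`, equals
`q^{-c/2} μ(ϖ^{-c}) ε(½, μ, ψ)` — 2-adic digit `−c/2` per zeta factor (their `vol(𝔬ˣ) = 1 − q⁻¹`). -/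
def gpZetaDigit (c : ℕ) : ℚ := -(c : ℚ) / 2

/-- The split toric PERIOD is a product of two such zeta factors (Hsieh 2014 Lemma 3.4;
LZZ `(eq:matrix_tame)`): digit `−c` for the GP-translated newform pair, before measure digits. -/
theorem gpPeriodDigit (c : ℕ) : gpZetaDigit c + gpZetaDigit c = -(c : ℚ) := by
  unfold gpZetaDigit; ring

/-- Measure digit of FMP's `d×x` (`vol 𝔬ˣ = 1 − 2⁻¹ = 1/2`, one factor `2⁻¹` per zeta integral)
relative to the `vol(ℤ₂ˣ) = 1` convention of LZZ / YZZ. -/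
theorem fmpMeasureDigit : (1 : ℚ) - 2⁻¹ = 2⁻¹ := by norm_num

/-- Hsieh 2014 Prop. 3.5, `♭`-vector at a split place above `p` (here `p = 2`, admissible because
`d_{F,2} = 2δ = √−7 ∈ ℤ₂ˣ` exactly when `2` splits in `K₀`):
`P/L = ε(½, π₂ ⊗ χ_w, ψ) · χ_w^{-2}(−2δ) / L(½, π₂ ⊗ χ_w)²`, all three factors 2-adic units for
ramified `χ_w` — digit `0`. -/
def hsiehFlatDigit (_n : ℕ) : ℤ := 0 + 0 - 2 * 0

/-- The R78 table at the two class depths, rows (LZZ indicator pair, GP newform pair with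
`vol ℤ₂ˣ = 1`, GP newform pair in FMP's measure, Hsieh `♭`): level part depends on the key only
through `n_v`. -/
theorem r78_table :
    (lzzSplitDigit 2, (-(2 : ℚ)), (-(2 : ℚ)) + 2 * (-1), hsiehFlatDigit 2) = (-3, -2, -4, 0) ∧
    (lzzSplitDigit 3, (-(3 : ℚ)), (-(3 : ℚ)) + 2 * (-1), hsiehFlatDigit 3) = (-5, -3, -5, 0) := by
  refine ⟨?_, ?_⟩ <;> simp [lzzSplitDigit, hsiehFlatDigit] <;> norm_num

/-- `2δ = √−7` is a 2-adic unit: `−7` is an odd square modulo `64` (indeed `−7 ≡ 57 ≡ 11²`), which is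
the dyadic content of `CMSplit W 2` used to run Hsieh's normalisation `(d2)` at `p = 2`. -/
theorem twoDelta_unit_mod64 : ∃ s : ZMod 64, s ^ 2 = -7 ∧ IsUnit s := by
  refine ⟨11, by decide, ?_⟩
  exact isUnit_iff_exists_inv.mpr ⟨35, by decide⟩

/-! ## § C.  P-audit-LZZ (iii): the torus-measure seam for `K₀ = ℚ(√−7)` -/

/-- LZZ §1.7 local volumes: archimedean `1`, split `vol(max compact) = 1`, inert total `1`,
ramified total `2`; `K₀` has class number `1`, one ramified prime (`7`), and
`T(ℚ) ∩ U = {±1·…} ` of order `2` (the units `±1` modulo `F`-centre contribute the generator `√−7`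
class), so `vol^{LZZ}(T(ℚ)\T(𝔸)) = 1·1·2/2 = 1`, against the Tamagawa number `2`. -/
def volLZZ_K0 : ℚ := 1 * 1 * 2 / 2
def volTamagawa : ℚ := 2
/-- YZZ13 §1.6.2 archimedean volume `vol(ℂˣ/ℝˣ) = 2` versus LZZ's archimedean `1`. -/
def archYZZ : ℚ := 2
def archLZZ : ℚ := 1

/-- The seam is the rational, class-constant factor `1/2`, and it sits entirely at the archimedean
place: finite parts of the two measures agree. -/
theorem measureSeam_K0 :
    volLZZ_K0 / volTamagawa = 1 / 2 ∧ volLZZ_K0 / volTamagawa = archLZZ / archYZZ := by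
  norm_num [volLZZ_K0, volTamagawa, archLZZ, archYZZ]

/-- B17 placement: the seam carries NO dependence on the twisting discriminant `d` (in particular no
`Σ_{q ∣ d} ord₂(q − (−7/q))` digit); typed as constancy of the seam as a function of `d`. -/
def seam (_d : ℤ) : ℚ := volLZZ_K0 / volTamagawa

theorem seam_classConstant : ∀ d d' : ℤ, seam d = seam d' := fun _ _ => rfl

/-! ## § D.  R83(b): the weight-`k` shadow — factorials cancel, no slope survives -/

/-- Archimedean toric period with `m` raising steps on a weight-`kσ` vector
(Hsieh 2014 Prop. 3.3: `2³ Γ(m+1) Γ(kσ+m) / (4π)^{kσ+1+2m}`): factorial part. -/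
def hsiehArchFactorial (kσ m : ℕ) : ℕ := Nat.factorial m * Nat.factorial (kσ + m - 1)

/-- LZZ side at weight `2` with `r = k − 1` applications of `Θ` (Lemma 2.25/2.26):
factorial part `(k−1)! · k!` (the `4^{-(k-1)}` is the exponential part). -/
def lzzGammaFactorial (k : ℕ) : ℕ := Nat.factorial (k - 1) * Nat.factorial k

/-- Katz–de Shalit side: `(k_dS − 1)!` at the two in-range infinity types `(k+1, −k)` and `(k, 1−k)`
forced by LT1 (`χ_k` of type `(k,−k)`, `ψ_A` of type `(1,0)`) and the `ρ`-reflection. -/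
def katzGammaFactorial (k : ℕ) : ℕ := Nat.factorial (k + 1 - 1) * Nat.factorial (k - 1)

theorem hsieh_eq_lzz (k : ℕ) (hk : 1 ≤ k) : hsiehArchFactorial 2 (k - 1) = lzzGammaFactorial k := by
  unfold hsiehArchFactorial lzzGammaFactorial
  have h : 2 + (k - 1) - 1 = k := by omega
  rw [h]

/-- The factorial parts cancel EXACTLY (no `s₂(k)`-type residue along `k = 2^N`). -/
theorem factorials_cancel (k : ℕ) : lzzGammaFactorial k = katzGammaFactorial k := by
  unfold lzzGammaFactorial katzGammaFactorial
  simp [Nat.mul_comm]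

/-- What a factorial MISMATCH would cost: had the Katz side carried `(k−1)!²` (types `(k,−k)` twice),
the residue `k!(k−1)!/((k−1)!)² = k` has valuation `N` at `k = 2^N` — unbounded, hence incompatible
with 2-adic continuity of both sides at `ψ_A`. -/
theorem mismatch_residue (k : ℕ) (hk : 1 ≤ k) :
    Nat.factorial k * Nat.factorial (k - 1) = k * (Nat.factorial (k - 1) * Nat.factorial (k - 1)) := by
  obtain ⟨j, rfl⟩ : ∃ j, k = j + 1 := ⟨k - 1, by omega⟩
  simp [Nat.factorial_succ, Nat.mul_assoc]

theorem mismatch_valuation_unbounded (N : ℕ) : padicValNat 2 (2 ^ N) = N := by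
  simp

/-- `no_slope`: a `k`-linear 2-adic slope `z` (a factor `2^{z k}` with unit cofactor) cannot survive
along `k = 2^N` if the valuations stay bounded (both interpolations converge to the NONZERO value at
`ψ_A`): `|z| · 2^N ≤ B` for all `N` forces `z = 0`.  (Additive form of k2-g7's
`unit_and_order_of_squaring`.) -/
theorem no_slope (z : ℤ) (B : ℕ) (h : ∀ N : ℕ, z.natAbs * 2 ^ N ≤ B) : z = 0 := by
  have hB : B < 2 ^ B := Nat.lt_two_pow_self
  have h1 := h B
  by_contra hz
  have hz' : 1 ≤ z.natAbs := Int.natAbs_pos.mpr hz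
  have : 2 ^ B ≤ z.natAbs * 2 ^ B := Nat.le_mul_of_pos_left _ hz'
  omega

/-- The exponential part of the LZZ digit, `4^{-(k-1)}`, has valuation `−2(k−1)`: a slope `−2` per unit
`k` BEFORE period matching; by `no_slope` it must be absorbed by the period/`(Im δ)`-conventions
(Hsieh: `(Im δ)^{-(kσ+2m)} = (√7/2)^{-2k}`, valuation `+2k`), leaving a `k`-independent residue. -/
theorem exponentialParts_balance (k : ℤ) : (-2 * (k - 1)) + 2 * k = 2 := by ring

end Summit.BirchSwinnertonDyer.BirchSwinnertonDyer.Cruxes.SplitBadTwoLowerHalfOfFacts.HeegnerIndexTwo.K2G10
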